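import Mathlib
import Literature.Probability.Percolation.PercolationProofs
import Literature.Probability.LatticeModels.ProdBernoulliIndependence
import Literature.Probability.LatticeModels.ProdBernoulliClusterLocality
import Literature.Probability.LatticeModels.ProdBernoulliCoupling
import Literature.Probability.Percolation.KozmaNitzanPinning
import Summits.CriticalPhenomena.PercolationContinuityZ3.Theorems.PercNearOneGluingAdditiveGluingGluingLemma5
import Summits.CriticalPhenomena.PercolationContinuityZ3.Theorems.PercNearOneGluingAdditiveGluingLemma5AnyRelay
import HarnessLib

/-! # Crux `PercNearOneGluing.AdditiveGluing` (stmt-CriticalPhenomena-4576), line `subuniform-dead-pocket-maximum`, stub `stub_goodStep` — the PEELING lemma (siege k24)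

Support file for the inductive step `stub_goodStep` ("goodness propagates to an observer with a
low neighbour") of the skeleton `Cruxes/AdditiveGluing/Lines/subuniform-dead-pocket-maximum.lean`.
Lands `--supports stmt-CriticalPhenomena-4576`.

## Content: Kozma–Nitzan's Lemma 5 with the LOW star kept ("peeling the high star")

Setting: the weighted complete graph on `Fin n` (`μ_w = prodBernoulli w`), an observer `o`, a
target `b ≠ o`, and a finite set `H ∌ o` of "high" neighbours of `o` (in the application,
`H = A`, the relays).  Write `F_H = {o–h | h ∈ H}` for the HIGH STAR and
`wᴸ = w` with every pair of `F_H` given weight `0` (the observer keeps only its LOW pairs, those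
leaving `o` towards vertices outside `H`).  For a pattern `B ⊆ H` let
`σᴴ_B = {ω | ∀ h ∈ H, o–h open ↔ h ∈ B}` (the high pairs open at `o` are exactly `o–B`; the low
pairs are free).

* `goodStep24_peel_pin` / `stub_goodStepPeel_k24` (**peeling lemma**, registered helper stub of the crux item).  If `v ∈ B ⊆ H` and `a` is at
  most as reliable as `v` in the LOW graph, `μ_{wᴸ}(a ↔ b) ≤ μ_{wᴸ}(v ↔ b)`, then
  `μ_w(σᴴ_B ∩ {a ↔ b}) ≤ μ_w(σᴴ_B ∩ {o ↔ b})`.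
  For `H = {all y ≠ o}` this is exactly KN Lemma 5 in `σ_B` form (the landed
  `stub_lemma5AnyRelay`, where `wᴸ` kills the whole star and `μ_{wᴸ}(x ↔ b) = μ_w(x ↔ b in {o}ᶜ)`);
  the point of the generalisation is that the comparison is made in the graph in which `o` KEEPS
  its low pairs, which is what the inductive step needs (the relay `argmin_A μ_{wᴸ}(· ↔ b)` is then
  admissible in every high branch simultaneously).
  Proof: verbatim the proof of `stub_lemma5AnyRelay` with the high star in place of the full
  star — conditioning on `σᴴ_B` is pinning on `F_H` (`prodBernoulli_real_inter_localCylinder`),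
  the pinned weighting is dominated by its wiring along `S = insert o B`, which is the gluing of
  `wᴸ` along `S`, so `stub_gluingLemma5` (hypothesis in `wᴸ`) and the wiring identity
  (`lemma5AnyRelay_wire_real_biUnion`) conclude.
* `goodStep24_peel_sum` (**summed form**).  If `μ_{wᴸ}(a ↔ b) ≤ μ_{wᴸ}(h ↔ b)` for EVERY `h ∈ H`, then
  `μ_w(a ↔ b) ≤ μ_w(o ↔ b) + μ_w(σᴴ_∅) · (μ_{wᴸ}(a ↔ b) − μ_{wᴸ}(o ↔ b))`
  (law of total probability over the patterns of `F_H`, `prodBernoulli_real_inter_eq_sum_pinW`;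
  the non-empty patterns are compared by the peeling lemma, the empty pattern is `wᴸ` itself).
  In words: the defect `τ(a) − P(o ↔ b)` of `G` is at most `P(no high pair open)` times the defect
  of the low graph.  Numerics (siege k24 lab, exact enumeration, 33 653 `(H, B, v, a)` tests on
  ≤ 7 vertices): 0 violations of the peeling lemma.

No new definitions (the two weightings appear as explicit lambdas, as in the skeleton).
-/

namespace Summit.CriticalPhenomena.PercolationContinuityZ3.Theorems

open MeasureTheory Set
open Literature.Probability.LatticeModels (prodBernoulli)
open Literature.Probability.Percolation (BondConfig openConn openConnIn openGraph openCluster)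

noncomputable section
open Classical

section GoodStep24PeelAux

open Filter
open Literature.Probability.LatticeModels Literature.Probability.Percolation

variable {n : ℕ}

/-- The high star `F_H = {o–h | h ∈ H}` as a finset of pairs, with its membership lemma.
[folklore] -/
theorem goodStep24_exists_highStar (o : Fin n) (H : Finset (Fin n)) :
    ∃ F : Finset (Sym2 (Fin n)), ∀ e, e ∈ (↑F : Set (Sym2 (Fin n))) ↔ ∃ h ∈ H, s(o, h) = e :=
  ⟨H.image fun h => s(o, h), fun e => by simp⟩

/-- **Peeling lemma, pinned form.**  Let `F` be the high star of `H ∌ o` at `o`, `T ⊆ F` a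
NON-EMPTY pattern, `pin = pinW w F T` (the pairs of `T` forced open, the other high pairs forced
closed, everything else — in particular the low pairs at `o` — untouched) and `wᴸ = w` with the
high star killed.  If `μ_{wᴸ}(a ↔ b) ≤ μ_{wᴸ}(v ↔ b)` for the endpoint `v` of some pair of `T`,
then `μ_pin(a ↔ b) ≤ μ_pin(o ↔ b)`.
Proof: `pin ≤ wireW S pin = glue wᴸ S` for `S = insert o {h ∈ H | o–h ∈ T}` (monotone coupling),
`stub_gluingLemma5` in `wᴸ`, and the wiring identity `μ_{wire S pin}(S ↔ b) = μ_pin(o ↔ b)`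
(`lemma5AnyRelay_wire_real_biUnion`, the pairs `o–y`, `y ∈ S`, being pinned open).
[cite: KozmaNitzan2024, §3.2 Lemma 5 (p. 13)] -/
theorem goodStep24_peel_pin (w : Sym2 (Fin n) → unitInterval) (o b a v : Fin n)
    (H : Finset (Fin n)) (F T : Finset (Sym2 (Fin n)))
    (hF : ∀ e, e ∈ (↑F : Set (Sym2 (Fin n))) ↔ ∃ h ∈ H, s(o, h) = e)
    (hbo : b ≠ o) (hoH : o ∉ H) (hvH : v ∈ H) (hvT : s(o, v) ∈ T)
    (hbT : s(o, b) ∉ T)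
    (hle : (prodBernoulli (fun e : Sym2 (Fin n) => if (∃ h ∈ H, s(o, h) = e) then 0 else w e)).real
        (openConn a b) ≤
      (prodBernoulli (fun e : Sym2 (Fin n) => if (∃ h ∈ H, s(o, h) = e) then 0 else w e)).real
        (openConn v b)) :
    (prodBernoulli (pinW w (↑F : Set (Sym2 (Fin n))) ↑T)).real (openConn a b) ≤
      (prodBernoulli (pinW w (↑F : Set (Sym2 (Fin n))) ↑T)).real (openConn o b) := by
  set w0 : Sym2 (Fin n) → unitInterval :=
    fun e => if (∃ h ∈ H, s(o, h) = e) then 0 else w e with hw0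
  -- the block `S = insert o B`, `B` = the endpoints of the pattern
  set B : Finset (Fin n) := H.filter fun h => s(o, h) ∈ T with hBdef
  have hB : ∀ y, y ∈ B ↔ y ∈ H ∧ s(o, y) ∈ T := fun y => by simp [hBdef]
  have hoB : o ∉ B := fun h => hoH ((hB o).1 h).1
  have hvB : v ∈ B := (hB v).2 ⟨hvH, hvT⟩
  have hvS : v ∈ insert o B := Finset.mem_insert_of_mem hvB
  have hbB : b ∉ B := fun h => hbT ((hB b).1 h).2
  have hbS : b ∉ insert o B := by simp [hbo, hbB]
  have hglue := stub_gluingLemma5 n w0 (insert o B) a v b hvS hbS hle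
  -- the glued weighting is the wiring of the pinned one
  have hW3 : ∀ e : Sym2 (Fin n),
      (if (∀ x ∈ e, x ∈ insert o B) ∧ ¬ e.IsDiag then (1 : unitInterval) else w0 e) =
        wireW (↑(insert o B) : Set (Fin n)) (pinW w ↑F ↑T) e := by
    intro e
    have hwire : e ∈ wireSet (↑(insert o B) : Set (Fin n)) ↔
        (∀ x ∈ e, x ∈ insert o B) ∧ ¬ e.IsDiag := by
      simp only [wireSet, Set.mem_setOf_eq, Finset.mem_coe]
    by_cases he : (∀ x ∈ e, x ∈ insert o B) ∧ ¬ e.IsDiag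
    · rw [if_pos he, wireW_apply_of_mem _ (hwire.2 he)]
    · rw [if_neg he, wireW_apply_of_not_mem _ fun h => he (hwire.1 h)]
      by_cases heF : e ∈ (↑F : Set (Sym2 (Fin n)))
      · obtain ⟨h, hhH, rfl⟩ := (hF e).1 heF
        have hw0e : w0 s(o, h) = 0 := by
          simp only [hw0]
          rw [if_pos ⟨h, hhH, rfl⟩]
        rw [hw0e]
        have hhT : s(o, h) ∉ (↑T : Set (Sym2 (Fin n))) := by
          intro hhT
          refine he ⟨fun x hx => ?_, fun hd => hoH ?_⟩
          · rcases Sym2.mem_iff.1 hx with hx' | hx'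
            · rw [hx']
              exact Finset.mem_insert_self _ _
            · rw [hx']
              exact Finset.mem_insert_of_mem ((hB h).2 ⟨hhH, Finset.mem_coe.1 hhT⟩)
          · rw [Sym2.mk_isDiag_iff.1 hd]
            exact hhH
        exact (pinW_apply_of_mem_of_not_mem w heF hhT).symm
      · have hne : ¬ (∃ h ∈ H, s(o, h) = e) := fun h => heF ((hF e).2 h)
        have hw0e : w0 e = w e := by
          simp only [hw0]
          rw [if_neg hne]
        rw [hw0e]
        exact (pinW_apply_of_not_mem w (↑T : Set (Sym2 (Fin n))) heF).symm
  rw [show (fun e : Sym2 (Fin n) =>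
      if (∀ x ∈ e, x ∈ insert o B) ∧ ¬ e.IsDiag then (1 : unitInterval) else w0 e) =
      wireW (↑(insert o B) : Set (Fin n)) (pinW w ↑F ↑T) from funext hW3] at hglue
  -- every pair `o–y`, `y ∈ B`, is pinned open
  have hW4 : ∀ y ∈ B, pinW w (↑F : Set (Sym2 (Fin n))) ↑T s(o, y) = 1 := fun y hy =>
    pinW_apply_of_mem_of_mem w ((hF _).2 ⟨y, ((hB y).1 hy).1, rfl⟩)
      (Finset.mem_coe.2 ((hB y).1 hy).2)
  calc (prodBernoulli (pinW w (↑F : Set (Sym2 (Fin n))) ↑T)).real (openConn a b)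
      ≤ (prodBernoulli (wireW (↑(insert o B) : Set (Fin n)) (pinW w ↑F ↑T))).real
          (openConn a b) :=
        prodBernoulli_real_mono_of_isUpperSet (le_wireW _ _) (isUpperSet_openConn a b)
          MeasurableSet.of_discrete
    _ ≤ (prodBernoulli (wireW (↑(insert o B) : Set (Fin n)) (pinW w ↑F ↑T))).real
          (⋃ s ∈ insert o B, openConn s b) := hglue
    _ = (prodBernoulli (pinW w (↑F : Set (Sym2 (Fin n))) ↑T)).real (openConn o b) :=
        lemma5AnyRelay_wire_real_biUnion _ o b B hoB hW4

/-- The event `σᴴ_B` ("the high pairs open at `o` are exactly `o–B`") is the cylinder over the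
high star `F` with pattern `{o–y | y ∈ B}`. [folklore] -/
theorem goodStep24_sigma_eq_localCylinder (o : Fin n) (H B : Finset (Fin n))
    (F : Finset (Sym2 (Fin n)))
    (hF : ∀ e, e ∈ (↑F : Set (Sym2 (Fin n))) ↔ ∃ h ∈ H, s(o, h) = e) :
    {ω : BondConfig (Fin n) | ∀ h ∈ H, (s(o, h) ∈ ω ↔ h ∈ B)} =
      localCylinder (↑F : Set (Sym2 (Fin n))) ↑(B.image fun y => s(o, y)) := by
  have hmemξ : ∀ y : Fin n, s(o, y) ∈ (↑(B.image fun y => s(o, y)) : Set (Sym2 (Fin n))) ↔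
      y ∈ B := by
    intro y
    rw [Finset.mem_coe, Finset.mem_image]
    constructor
    · rintro ⟨y', hy', hyy'⟩
      rwa [← Sym2.congr_right.1 hyy']
    · exact fun hy => ⟨y, hy, rfl⟩
  ext ω
  constructor
  · intro hω e he
    obtain ⟨h, hhH, rfl⟩ := (hF e).1 he
    rw [hmemξ]
    exact hω h hhH
  · intro hω h hhH
    rw [← hmemξ h]
    exact hω _ ((hF _).2 ⟨h, hhH, rfl⟩)

end GoodStep24PeelAux

open Filter Literature.Probability.LatticeModels Literature.Probability.Percolation in
/-- **Peeling lemma (KN Lemma 5 keeping the low star), `σ`-form.**  For `b ≠ o`, `o ∉ H`,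
`v ∈ B ⊆ H` and `wᴸ = w` with the pairs `o–h`, `h ∈ H`, killed: if
`μ_{wᴸ}(a ↔ b) ≤ μ_{wᴸ}(v ↔ b)` then `μ_w(σᴴ_B ∩ {a ↔ b}) ≤ μ_w(σᴴ_B ∩ {o ↔ b})`, where
`σᴴ_B = {ω | ∀ h ∈ H, o–h open ↔ h ∈ B}` (the low pairs at `o` are unconstrained).
With `H = {y | y ≠ o}` this is `stub_lemma5AnyRelay`; see the module docstring.
[cite: KozmaNitzan2024, §3.2 Lemma 5 (p. 13)] -/
theorem stub_goodStepPeel_k24 :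
    ∀ (n : ℕ) (w : Sym2 (Fin n) → unitInterval) (o b a v : Fin n) (H B : Finset (Fin n)),
      b ≠ o → o ∉ H → B ⊆ H → v ∈ B →
      (prodBernoulli (fun e : Sym2 (Fin n) => if (∃ h ∈ H, s(o, h) = e) then 0 else w e)).real
          (openConn a b) ≤
        (prodBernoulli (fun e : Sym2 (Fin n) => if (∃ h ∈ H, s(o, h) = e) then 0 else w e)).real
          (openConn v b) →
      (prodBernoulli w).real
          ({ω : BondConfig (Fin n) | ∀ h ∈ H, (s(o, h) ∈ ω ↔ h ∈ B)} ∩ openConn a b)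
        ≤ (prodBernoulli w).real
          ({ω : BondConfig (Fin n) | ∀ h ∈ H, (s(o, h) ∈ ω ↔ h ∈ B)} ∩ openConn o b) := by
  intro n w o b a v H B hbo hoH hBH hvB hle
  -- Case `b ∈ B`: under `σᴴ_B` the pair `o–b` is open, so `σᴴ_B ⊆ {o ↔ b}`.
  by_cases hbB : b ∈ B
  · have hsub : {ω : BondConfig (Fin n) | ∀ h ∈ H, (s(o, h) ∈ ω ↔ h ∈ B)} ⊆ openConn o b :=
      fun ω hω => ((openGraph_adj ω o b).2 ⟨(hω b (hBH hbB)).2 hbB, hbo.symm⟩).reachable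
    rw [Set.inter_eq_left.2 hsub]
    exact measureReal_mono Set.inter_subset_left (measure_ne_top _ _)
  obtain ⟨F, hF⟩ := goodStep24_exists_highStar o H
  rw [goodStep24_sigma_eq_localCylinder o H B F hF]
  have hcond : ∀ X : Set (BondConfig (Fin n)),
      (prodBernoulli w).real
          (localCylinder (↑F : Set (Sym2 (Fin n))) ↑(B.image fun y => s(o, y)) ∩ X) =
        (prodBernoulli w).real (localCylinder (↑F : Set (Sym2 (Fin n))) ↑(B.image fun y => s(o, y))) *
          (prodBernoulli (pinW w ↑F ↑(B.image fun y => s(o, y)))).real X := fun X => by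
    rw [Set.inter_comm]
    exact prodBernoulli_real_inter_localCylinder w F _ MeasurableSet.of_discrete
  rw [hcond, hcond]
  refine mul_le_mul_of_nonneg_left ?_ measureReal_nonneg
  refine goodStep24_peel_pin w o b a v H F _ hF hbo hoH (hBH hvB) ?_ ?_ hle
  · exact Finset.mem_image.2 ⟨v, hvB, rfl⟩
  · intro h
    obtain ⟨y, hy, hyb⟩ := Finset.mem_image.1 h
    exact hbB ((Sym2.congr_right.1 hyb) ▸ hy)

open Filter Literature.Probability.LatticeModels Literature.Probability.Percolation in
/-- **Peeling lemma, summed form.**  For `b ≠ o`, `o ∉ H` and `wᴸ = w` with the pairs `o–h`,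
`h ∈ H`, killed: if `μ_{wᴸ}(a ↔ b) ≤ μ_{wᴸ}(h ↔ b)` for every `h ∈ H`, then
`μ_w(a ↔ b) ≤ μ_w(o ↔ b) + μ_w(σᴴ_∅) · (μ_{wᴸ}(a ↔ b) − μ_{wᴸ}(o ↔ b))`,
`σᴴ_∅ = {ω | ∀ h ∈ H, o–h closed}`: the defect of `a` against the observer is at most the
probability that no high pair is open times the defect in the low graph.  Law of total
probability over the patterns of the high star (`prodBernoulli_real_inter_eq_sum_pinW`), the
peeling lemma on every non-empty pattern, and `pinW w F ∅ = wᴸ` on the empty one.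
[cite: KozmaNitzan2024, §3.2 (proof of Thm 4, pp. 13–14)] -/
theorem goodStep24_peel_sum :
    ∀ (n : ℕ) (w : Sym2 (Fin n) → unitInterval) (o b a : Fin n) (H : Finset (Fin n)),
      b ≠ o → o ∉ H →
      (∀ h ∈ H,
        (prodBernoulli (fun e : Sym2 (Fin n) => if (∃ h ∈ H, s(o, h) = e) then 0 else w e)).real
            (openConn a b) ≤
          (prodBernoulli (fun e : Sym2 (Fin n) => if (∃ h ∈ H, s(o, h) = e) then 0 else w e)).real
            (openConn h b)) →
      (prodBernoulli w).real (openConn a b) ≤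
        (prodBernoulli w).real (openConn o b) +
          (prodBernoulli w).real {ω : BondConfig (Fin n) | ∀ h ∈ H, s(o, h) ∉ ω} *
            ((prodBernoulli (fun e : Sym2 (Fin n) =>
                if (∃ h ∈ H, s(o, h) = e) then 0 else w e)).real (openConn a b) -
              (prodBernoulli (fun e : Sym2 (Fin n) =>
                if (∃ h ∈ H, s(o, h) = e) then 0 else w e)).real (openConn o b)) := by
  intro n w o b a H hbo hoH hle
  set w0 : Sym2 (Fin n) → unitInterval :=
    fun e => if (∃ h ∈ H, s(o, h) = e) then 0 else w e with hw0
  obtain ⟨F, hF⟩ := goodStep24_exists_highStar o H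
  -- law of total probability over the patterns `T ⊆ F`
  have htot : ∀ X : Set (BondConfig (Fin n)), (prodBernoulli w).real X =
      ∑ T ∈ F.powerset, (prodBernoulli w).real (localCylinder (↑F : Set (Sym2 (Fin n))) ↑T) *
        (prodBernoulli (pinW w ↑F ↑T)).real X := by
    intro X
    have h := prodBernoulli_real_inter_eq_sum_pinW w F (A := X) (B := Set.univ)
      MeasurableSet.of_discrete (determinedBy_univ _)
    rw [Set.inter_univ] at h
    rw [h]
    refine Finset.sum_congr ?_ fun T _ => rfl
    ext T
    simp
  -- the empty pattern: `pinW w F ∅ = wᴸ` and `[∅]_F = σᴴ_∅`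
  have hpin0 : pinW w (↑F : Set (Sym2 (Fin n))) ↑(∅ : Finset (Sym2 (Fin n))) = w0 := by
    funext e
    rw [pinW_apply]
    by_cases he : e ∈ (↑F : Set (Sym2 (Fin n)))
    · have he' : ∃ h ∈ H, s(o, h) = e := (hF e).1 he
      simp only [hw0]
      rw [if_pos he, if_pos he', Finset.coe_empty, if_neg (Set.notMem_empty e)]
    · have he' : ¬ ∃ h ∈ H, s(o, h) = e := fun h => he ((hF e).2 h)
      simp only [hw0]
      rw [if_neg he, if_neg he']
  have hcyl0 : localCylinder (↑F : Set (Sym2 (Fin n))) ↑(∅ : Finset (Sym2 (Fin n))) =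
      {ω : BondConfig (Fin n) | ∀ h ∈ H, s(o, h) ∉ ω} := by
    ext ω
    simp only [localCylinder, Finset.coe_empty, Set.mem_empty_iff_false, iff_false,
      Set.mem_setOf_eq]
    constructor
    · intro hω h hh
      exact hω _ ((hF _).2 ⟨h, hh, rfl⟩)
    · intro hω e he
      obtain ⟨h, hh, rfl⟩ := (hF e).1 he
      exact hω h hh
  -- termwise comparison
  have hterm : ∀ T ∈ F.powerset,
      (prodBernoulli w).real (localCylinder (↑F : Set (Sym2 (Fin n))) ↑T) *
          (prodBernoulli (pinW w ↑F ↑T)).real (openConn a b) ≤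
        (prodBernoulli w).real (localCylinder (↑F : Set (Sym2 (Fin n))) ↑T) *
            (prodBernoulli (pinW w ↑F ↑T)).real (openConn o b) +
          (if T = ∅ then
            (prodBernoulli w).real {ω : BondConfig (Fin n) | ∀ h ∈ H, s(o, h) ∉ ω} *
              ((prodBernoulli w0).real (openConn a b) - (prodBernoulli w0).real (openConn o b))
           else 0) := by
    intro T hT
    have hTF : T ⊆ F := Finset.mem_powerset.1 hT
    by_cases hT0 : T = ∅
    · subst hT0
      rw [if_pos rfl, hpin0, hcyl0]
      nlinarith [measureReal_nonneg (μ := prodBernoulli w)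
        (s := {ω : BondConfig (Fin n) | ∀ h ∈ H, s(o, h) ∉ ω})]
    · rw [if_neg hT0, add_zero]
      refine mul_le_mul_of_nonneg_left ?_ measureReal_nonneg
      -- a pair `o–v ∈ T`
      obtain ⟨e, heT⟩ := Finset.nonempty_iff_ne_empty.2 hT0
      obtain ⟨v, hvH, rfl⟩ := (hF e).1 (Finset.mem_coe.2 (hTF heT))
      by_cases hbT : s(o, b) ∈ T
      · -- then `o–b` is pinned open and `μ_pin(o ↔ b) = 1`
        have hb1 : pinW w (↑F : Set (Sym2 (Fin n))) ↑T s(o, b) = 1 :=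
          pinW_apply_of_mem_of_mem w (Finset.mem_coe.2 (hTF hbT)) (Finset.mem_coe.2 hbT)
        have hob : (prodBernoulli (pinW w (↑F : Set (Sym2 (Fin n))) ↑T)).real (openConn o b) = 1 := by
          rw [← probReal_univ (μ := prodBernoulli (pinW w (↑F : Set (Sym2 (Fin n))) ↑T))]
          refine measureReal_congr ?_
          filter_upwards [prodBernoulli_ae_mem_of_eq_one _ hb1] with ω hω
          exact propext ⟨fun _ => trivial, fun _ =>
            ((openGraph_adj ω o b).2 ⟨hω, hbo.symm⟩).reachable⟩
        rw [hob]
        exact measureReal_le_one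
      · exact goodStep24_peel_pin w o b a v H F T hF hbo hoH hvH heT hbT (hle v hvH)
  calc (prodBernoulli w).real (openConn a b)
      = ∑ T ∈ F.powerset, (prodBernoulli w).real (localCylinder (↑F : Set (Sym2 (Fin n))) ↑T) *
          (prodBernoulli (pinW w ↑F ↑T)).real (openConn a b) := htot _
    _ ≤ ∑ T ∈ F.powerset,
          ((prodBernoulli w).real (localCylinder (↑F : Set (Sym2 (Fin n))) ↑T) *
              (prodBernoulli (pinW w ↑F ↑T)).real (openConn o b) +
            (if T = ∅ then
              (prodBernoulli w).real {ω : BondConfig (Fin n) | ∀ h ∈ H, s(o, h) ∉ ω} *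
                ((prodBernoulli w0).real (openConn a b) - (prodBernoulli w0).real (openConn o b))
             else 0)) := Finset.sum_le_sum hterm
    _ = (prodBernoulli w).real (openConn o b) +
          (prodBernoulli w).real {ω : BondConfig (Fin n) | ∀ h ∈ H, s(o, h) ∉ ω} *
            ((prodBernoulli w0).real (openConn a b) - (prodBernoulli w0).real (openConn o b)) := by
        rw [Finset.sum_add_distrib, ← htot, Finset.sum_ite_eq' F.powerset ∅, if_pos
          (Finset.mem_powerset.2 (Finset.empty_subset F))]

end

end Summit.CriticalPhenomena.PercolationContinuityZ3.Theorems
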